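import Summits.Ventures.PercRepro.C041TriDomExcessTriangle
import Summits.Ventures.PercRepro.C041TriDomExcessZeroDouble

/-!
# ROW C-041 — THE EQUALITY CASE OF THE EXCESS, VI: A TRIANGLE OR A STAR MINOR ON THE MARKS FORCES `e ≥ 1`
(p6, gen 43; §53 ADDENDUM 2)

The converse of THEOREM (SEPARABLE ⟹ THE EXCESS VANISHES) on every host that has a CYCLE or a TRIPOD through its
marks, stated at the level of statuses: a status `st` whose free edges are exactly `f₁, f₂, f₃` (every other present
edge DOUBLE, i.e. contracted) is a TRIANGLE MINOR on the marks if the double-components (`DConn`) of `a₁, u, u'` are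
pairwise distinct and `f₁` joins the components of `a₁` and `u`, `f₂` those of `a₁` and `u'`, `f₃` those of `u` and
`u'` (`TriMinor`); it is a STAR MINOR if there is a centre `c` in a fourth component and `f₁, f₂, f₃` join the
component of `c` to those of `a₁, u, u'` (`StarMinor`).  A host admitting such a status — every host with a cycle or
a tripod through its marks, by contracting all but one edge on every arc and deleting the rest — has excess `≥ 1`
(`excess_ge_one_of_triMinor`, `excess_ge_one_of_starMinor`).  PROOF: the connectivity invariant of
`C041TriDomExcessTriangleStatus` transported along the double-components (`RdS_triMinor_iff`, `RdS_starMinor_iff`: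
the red pattern is `triPat (p, q, r)` resp. `starPat (p, q, r) = (p∧q, p∧r, q∧r)` in the colours of `f₁, f₂, f₃`, the
blue one the same in their negations), the fibre count of part V, and the deletion–contraction chain
`esym_setStatus_le` (`esym_absent_le` / `esym_double_le` on the `#E₁ − 3` non-free edges).  The Menger-type
existence of the minor on a connected non-separable host stays paper (ADDENDUM 2).
-/

namespace PercRepro

namespace ZoneZ

namespace MultiExit

open ZoneData Finset

variable {V₁ E₁ U₁ U₂ : Type} (Z₁ : ZoneData V₁ E₁ U₁ U₂) (u u' a₁ : V₁)

/-! ## Statuses with three free edges -/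

/-- The free edges of `st` are exactly `f₁, f₂, f₃`. -/
def ThreeFree (st : E₁ → EStat) (f₁ f₂ f₃ : E₁) : Prop :=
  st f₁ = .free ∧ st f₂ = .free ∧ st f₃ = .free ∧ ∀ e, e ≠ f₁ → e ≠ f₂ → e ≠ f₃ → st e ≠ .free

/-- Red edges of a three-free status: the double edges and the red free ones. -/
theorem redE_threeFree {st : E₁ → EStat} {f₁ f₂ f₃ : E₁} (h : ThreeFree st f₁ f₂ f₃) (ω : E₁ → Bool) (e : E₁) :
    redE st ω e ↔ (dblE st e ∨ ((e = f₁ ∨ e = f₂ ∨ e = f₃) ∧ ω e = true)) := by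
  obtain ⟨h1, h2, h3, h4⟩ := h
  unfold redE dblE
  constructor
  · rintro (hd | ⟨hf, hω⟩)
    · exact Or.inl hd
    · by_contra hc
      rw [not_or, not_and_or] at hc
      rcases hc.2 with hc2 | hc2
      · rw [not_or, not_or] at hc2
        exact h4 e hc2.1 hc2.2.1 hc2.2.2 hf
      · exact hc2 hω
  · rintro (hd | ⟨hf, hω⟩)
    · exact Or.inl hd
    · refine Or.inr ⟨?_, hω⟩
      rcases hf with rfl | rfl | rfl
      · exact h1
      · exact h2
      · exact h3

/-- Blue edges of a three-free status: the double edges and the blue free ones. -/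
theorem blueE_threeFree {st : E₁ → EStat} {f₁ f₂ f₃ : E₁} (h : ThreeFree st f₁ f₂ f₃) (ω : E₁ → Bool) (e : E₁) :
    blueE st ω e ↔ (dblE st e ∨ ((e = f₁ ∨ e = f₂ ∨ e = f₃) ∧ ω e = false)) := by
  obtain ⟨h1, h2, h3, h4⟩ := h
  unfold blueE dblE
  constructor
  · rintro (hd | ⟨hf, hω⟩)
    · exact Or.inl hd
    · by_contra hc
      rw [not_or, not_and_or] at hc
      rcases hc.2 with hc2 | hc2
      · rw [not_or, not_or] at hc2
        exact h4 e hc2.1 hc2.2.1 hc2.2.2 hf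
      · exact hc2 hω
  · rintro (hd | ⟨hf, hω⟩)
    · exact Or.inl hd
    · refine Or.inr ⟨?_, hω⟩
      rcases hf with rfl | rfl | rfl
      · exact h1
      · exact h2
      · exact h3

/-- Double connectivity is symmetric. -/
theorem DConn_symm {st : E₁ → EStat} {k v : V₁} (h : DConn Z₁ st k v) : DConn Z₁ st v k :=
  reach_trans_of_symm (AdjCol_symm Z₁ (dblE st)) h (mem_reach_self _ _)

/-- Double connectivity composes. -/
theorem DConn_trans {st : E₁ → EStat} {k x v : V₁} (h1 : DConn Z₁ st k x) (h2 : DConn Z₁ st x v) :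
    DConn Z₁ st k v :=
  reach_trans' h1 h2

/-- Reflexivity of double connectivity. -/
theorem DConn_refl (st : E₁ → EStat) (k : V₁) : DConn Z₁ st k k := mem_reach_self _ _

/-- A double edge joins double-connected vertices. -/
theorem DConn_of_dblE {st : E₁ → EStat} {e : E₁} {v w : V₁} (hd : dblE st e) (hj : Z₁.Joins e v w) :
    DConn Z₁ st v w :=
  Relation.ReflTransGen.single ⟨e, hj, hd⟩ |> (mem_reach_singleton _ _ _).2

/-! ## The triangle minor -/

/-- `st` is a TRIANGLE MINOR on the marks: three free edges joining the pairwise distinct double-components of the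
marks (`f₁ : a₁–u`, `f₂ : a₁–u'`, `f₃ : u–u'`). -/
structure TriMinor (st : E₁ → EStat) (f₁ f₂ f₃ : E₁) : Prop where
  three : ThreeFree st f₁ f₂ f₃
  nau : ¬ DConn Z₁ st a₁ u
  nau' : ¬ DConn Z₁ st a₁ u'
  nuu' : ¬ DConn Z₁ st u u'
  j1 : ∃ x y, Z₁.Joins f₁ x y ∧ DConn Z₁ st a₁ x ∧ DConn Z₁ st u y
  j2 : ∃ x y, Z₁.Joins f₂ x y ∧ DConn Z₁ st a₁ x ∧ DConn Z₁ st u' y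
  j3 : ∃ x y, Z₁.Joins f₃ x y ∧ DConn Z₁ st u x ∧ DConn Z₁ st u' y

/-- Connectivity from `a` to `b` in a triangle minor with blocks `a, b, c`, through the double edges and the edges
`e₁ : a–b`, `e₂ : a–c`, `e₃ : b–c` satisfying `P`: `P e₁ ∨ (P e₂ ∧ P e₃)`. -/
theorem reach_triMinor_iff {st : E₁ → EStat} {a b c : V₁} {e₁ e₂ e₃ : E₁}
    (hab : ¬ DConn Z₁ st a b) (hac : ¬ DConn Z₁ st a c) (hbc : ¬ DConn Z₁ st b c)
    (j1 : ∃ x y, Z₁.Joins e₁ x y ∧ DConn Z₁ st a x ∧ DConn Z₁ st b y)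
    (j2 : ∃ x y, Z₁.Joins e₂ x y ∧ DConn Z₁ st a x ∧ DConn Z₁ st c y)
    (j3 : ∃ x y, Z₁.Joins e₃ x y ∧ DConn Z₁ st b x ∧ DConn Z₁ st c y) (P : E₁ → Prop) :
    Relation.ReflTransGen (AdjCol Z₁ fun e => dblE st e ∨ ((e = e₁ ∨ e = e₂ ∨ e = e₃) ∧ P e)) a b ↔
      (P e₁ ∨ (P e₂ ∧ P e₃)) := by
  obtain ⟨x₁, y₁, hj1, hx1, hy1⟩ := j1
  obtain ⟨x₂, y₂, hj2, hx2, hy2⟩ := j2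
  obtain ⟨x₃, y₃, hj3, hx3, hy3⟩ := j3
  constructor
  · intro h
    have key : ∀ v, Relation.ReflTransGen (AdjCol Z₁ fun e => dblE st e ∨ ((e = e₁ ∨ e = e₂ ∨ e = e₃) ∧ P e)) a v →
        DConn Z₁ st a v ∨ (DConn Z₁ st b v ∧ (P e₁ ∨ (P e₂ ∧ P e₃))) ∨
          (DConn Z₁ st c v ∧ (P e₂ ∨ (P e₁ ∧ P e₃))) := by
      intro v hv
      induction hv with
      | refl => exact Or.inl (DConn_refl Z₁ st a)
      | @tail w v _ hwv ih =>
        obtain ⟨e, hj, he⟩ := hwv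
        rcases he with hd | ⟨he, hP⟩
        · -- a double edge transports every disjunct
          have hwv' := DConn_of_dblE Z₁ hd hj
          rcases ih with h | ⟨h, hh⟩ | ⟨h, hh⟩
          · exact Or.inl (DConn_trans Z₁ h hwv')
          · exact Or.inr (Or.inl ⟨DConn_trans Z₁ h hwv', hh⟩)
          · exact Or.inr (Or.inr ⟨DConn_trans Z₁ h hwv', hh⟩)
        · rcases he with rfl | rfl | rfl
          · -- the edge `e₁ : a–b`
            rcases joins_unique hj1 hj with ⟨_, hv⟩ | ⟨_, hv⟩
            · subst hv; exact Or.inr (Or.inl ⟨hy1, Or.inl hP⟩)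
            · subst hv; exact Or.inl hx1
          · -- the edge `e₂ : a–c`
            rcases joins_unique hj2 hj with ⟨_, hv⟩ | ⟨_, hv⟩
            · subst hv; exact Or.inr (Or.inr ⟨hy2, Or.inl hP⟩)
            · subst hv; exact Or.inl hx2
          · -- the edge `e₃ : b–c`
            rcases joins_unique hj3 hj with ⟨hw, hv⟩ | ⟨hw, hv⟩
            · -- from the block of `b` to the block of `c`
              subst hw; subst hv
              rcases ih with h | ⟨_, hh⟩ | ⟨h, _⟩
              · exact absurd (DConn_trans Z₁ h (DConn_symm Z₁ hx3)) hab
              · refine Or.inr (Or.inr ⟨hy3, ?_⟩)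
                rcases hh with hp | ⟨hq, _⟩
                · exact Or.inr ⟨hp, hP⟩
                · exact Or.inl hq
              · exact absurd (DConn_symm Z₁ (DConn_trans Z₁ h (DConn_symm Z₁ hx3))) hbc
            · -- from the block of `c` to the block of `b`
              subst hw; subst hv
              rcases ih with h | ⟨h, _⟩ | ⟨_, hh⟩
              · exact absurd (DConn_trans Z₁ h (DConn_symm Z₁ hy3)) hac
              · exact absurd (DConn_trans Z₁ h (DConn_symm Z₁ hy3)) hbc
              · refine Or.inr (Or.inl ⟨hx3, ?_⟩)
                rcases hh with hq | ⟨hp, _⟩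
                · exact Or.inr ⟨hq, hP⟩
                · exact Or.inl hp
    rcases key b h with hb | ⟨_, hb⟩ | ⟨hb, _⟩
    · exact absurd hb hab
    · exact hb
    · exact absurd (DConn_symm Z₁ hb) hbc
  · -- the explicit walks
    have hdbl : ∀ {v w : V₁}, DConn Z₁ st v w →
        Relation.ReflTransGen (AdjCol Z₁ fun e => dblE st e ∨ ((e = e₁ ∨ e = e₂ ∨ e = e₃) ∧ P e)) v w := by
      intro v w hvw
      unfold DConn at hvw
      rw [mem_reach_singleton] at hvw
      induction hvw with
      | refl => exact Relation.ReflTransGen.refl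
      | tail _ hxy ih =>
        obtain ⟨e, hj, hd⟩ := hxy
        exact ih.tail ⟨e, hj, Or.inl hd⟩
    rintro (hp | ⟨hq, hr⟩)
    · exact ((hdbl hx1).tail ⟨e₁, hj1, Or.inr ⟨Or.inl rfl, hp⟩⟩).trans (hdbl (DConn_symm Z₁ hy1))
    · refine (((hdbl hx2).tail ⟨e₂, hj2, Or.inr ⟨Or.inr (Or.inl rfl), hq⟩⟩).trans
        (hdbl (DConn_trans Z₁ (DConn_symm Z₁ hy2) hy3))).trans ?_
      exact (Relation.ReflTransGen.single ⟨e₃, Joins_symm Z₁ hj3, Or.inr ⟨Or.inr (Or.inr rfl), hr⟩⟩).trans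
        (hdbl (DConn_symm Z₁ hx3))

/-- Red connectivity `a₁ ~ u` in a triangle minor. -/
theorem RdS_triMinor_iff {st : E₁ → EStat} {f₁ f₂ f₃ : E₁} (h : TriMinor Z₁ u u' a₁ st f₁ f₂ f₃) (ω : E₁ → Bool) :
    RdS Z₁ st ω a₁ u ↔ (ω f₁ = true ∨ (ω f₂ = true ∧ ω f₃ = true)) := by
  unfold RdS
  rw [mem_reach_singleton]
  have hadj : RAdjS Z₁ st ω = AdjCol Z₁ fun e => dblE st e ∨ ((e = f₁ ∨ e = f₂ ∨ e = f₃) ∧ ω e = true) := by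
    funext x y
    exact propext (exists_congr fun e => and_congr_right fun _ => redE_threeFree h.three ω e)
  rw [hadj]
  exact reach_triMinor_iff Z₁ h.nau h.nau' h.nuu' h.j1 h.j2 h.j3 _

/-- Blue connectivity `a₁ ~ u` in a triangle minor. -/
theorem MgS_triMinor_iff {st : E₁ → EStat} {f₁ f₂ f₃ : E₁} (h : TriMinor Z₁ u u' a₁ st f₁ f₂ f₃) (ω : E₁ → Bool) :
    MgS Z₁ st ω a₁ u ↔ (ω f₁ = false ∨ (ω f₂ = false ∧ ω f₃ = false)) := by
  unfold MgS
  rw [mem_reach_singleton]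
  have hadj : BAdjS Z₁ st ω = AdjCol Z₁ fun e => dblE st e ∨ ((e = f₁ ∨ e = f₂ ∨ e = f₃) ∧ ω e = false) := by
    funext x y
    exact propext (exists_congr fun e => and_congr_right fun _ => blueE_threeFree h.three ω e)
  rw [hadj]
  exact reach_triMinor_iff Z₁ h.nau h.nau' h.nuu' h.j1 h.j2 h.j3 _

/-- A triangle minor with the exits exchanged (and `f₁ ↔ f₂`). -/
theorem TriMinor.eswap {st : E₁ → EStat} {f₁ f₂ f₃ : E₁} (h : TriMinor Z₁ u u' a₁ st f₁ f₂ f₃) :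
    TriMinor Z₁ u' u a₁ st f₂ f₁ f₃ where
  three := ⟨h.three.2.1, h.three.1, h.three.2.2.1, fun e h1 h2 h3 => h.three.2.2.2 e h2 h1 h3⟩
  nau := h.nau'
  nau' := h.nau
  nuu' := fun hc => h.nuu' (DConn_symm Z₁ hc)
  j1 := h.j2
  j2 := h.j1
  j3 := by
    obtain ⟨x, y, hj, hx, hy⟩ := h.j3
    exact ⟨y, x, Joins_symm Z₁ hj, hy, hx⟩

/-- A triangle minor with the marks rotated (anchor `u'`, exits `u`, `a₁`; edges `f₃, f₂, f₁`). -/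
theorem TriMinor.rot' {st : E₁ → EStat} {f₁ f₂ f₃ : E₁} (h : TriMinor Z₁ u u' a₁ st f₁ f₂ f₃) :
    TriMinor Z₁ u a₁ u' st f₃ f₂ f₁ where
  three := ⟨h.three.2.2.1, h.three.2.1, h.three.1, fun e h3 h2 h1 => h.three.2.2.2 e h1 h2 h3⟩
  nau := fun hc => h.nuu' (DConn_symm Z₁ hc)
  nau' := fun hc => h.nau' (DConn_symm Z₁ hc)
  nuu' := fun hc => h.nau (DConn_symm Z₁ hc)
  j1 := by
    obtain ⟨x, y, hj, hx, hy⟩ := h.j3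
    exact ⟨y, x, Joins_symm Z₁ hj, hy, hx⟩
  j2 := by
    obtain ⟨x, y, hj, hx, hy⟩ := h.j2
    exact ⟨y, x, Joins_symm Z₁ hj, hy, hx⟩
  j3 := by
    obtain ⟨x, y, hj, hx, hy⟩ := h.j1
    exact ⟨y, x, Joins_symm Z₁ hj, hy, hx⟩

open Classical in
/-- THE RED PATTERN OF A TRIANGLE MINOR. -/
theorem rsig_triMinor {st : E₁ → EStat} {f₁ f₂ f₃ : E₁} (h : TriMinor Z₁ u u' a₁ st f₁ f₂ f₃) (ω : E₁ → Bool) :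
    rsig Z₁ u u' a₁ st ω = triPat (ω f₁) (ω f₂) (ω f₃) := by
  have e1 := RdS_triMinor_iff Z₁ u u' a₁ h ω
  have e2 := RdS_triMinor_iff Z₁ u' u a₁ h.eswap ω
  have e3 := RdS_triMinor_iff Z₁ u a₁ u' h.rot' ω
  unfold rsig triPat
  refine Prod.ext (decide_eq_of_iff ?_) (Prod.ext (decide_eq_of_iff ?_) (decide_eq_of_iff ?_))
  · rw [e1]; simp
  · rw [e2]; simp
  · rw [show RdS Z₁ st ω u u' ↔ RdS Z₁ st ω u' u from ⟨RdS_symm Z₁ st ω, RdS_symm Z₁ st ω⟩, e3]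
    simp only [Bool.or_eq_true, Bool.and_eq_true]
    exact or_congr_right and_comm

open Classical in
/-- THE BLUE PATTERN OF A TRIANGLE MINOR. -/
theorem bsig_triMinor {st : E₁ → EStat} {f₁ f₂ f₃ : E₁} (h : TriMinor Z₁ u u' a₁ st f₁ f₂ f₃) (ω : E₁ → Bool) :
    bsig Z₁ u u' a₁ st ω = triPat (!ω f₁) (!ω f₂) (!ω f₃) := by
  have e1 := MgS_triMinor_iff Z₁ u u' a₁ h ω
  have e2 := MgS_triMinor_iff Z₁ u' u a₁ h.eswap ω
  have e3 := MgS_triMinor_iff Z₁ u a₁ u' h.rot' ω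
  unfold bsig triPat
  refine Prod.ext (decide_eq_of_iff ?_) (Prod.ext (decide_eq_of_iff ?_) (decide_eq_of_iff ?_))
  · rw [e1]; simp
  · rw [e2]; simp
  · rw [show MgS Z₁ st ω u u' ↔ MgS Z₁ st ω u' u from ⟨MgS_symm Z₁ st ω, MgS_symm Z₁ st ω⟩, e3]
    cases ω f₁ <;> cases ω f₂ <;> cases ω f₃ <;> simp

end MultiExit

end ZoneZ

end PercRepro
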